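import Literature.NumberTheory.DiophantineGeometry.DetOrbitSymKroneckerBound
import HarnessLib
import HarnessLib.Audit

/-!
# Typed cell conjecture C-C1-1″ (track K): positivity of the rectangular symmetric Kronecker coefficient on
# even partitions — typed by lit-1 (gen 5, 2026-08-23) under the cell's standing rule (5), TRIGGERED by the
# referee's grading of pre-registration P-027 (HOME/INBOX.md l.388) and the lead's D104/D108 (l.393).

Cell `pub-gct-max` (HOME `run/shared/lean/pub/pub-gct-max/`), track K (census-1: law and evidence,
kron/FLAGS.md F3/F4/F5/F7; theory-3: adoption into STRUCTURE.md §2 as the secondary conjecture C-C1-1″ and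
pre-registration kron/PREREG/P-027.md `c1155a49811bf154…`), typed by track T (lit-1). Companion prose:
`HOME/typed/AS-PRINTED-1.md` §8.4 (vocabulary, placement). This file ASSERTS NOTHING: it defines a statement
(`def … : Prop`, tagged `@[conjecture]` = an obligation node of our theories, NOT a published theorem) with an
unfolding `example` and elementary `example`s on the excepted two-column type. HONEST FRAMING: multiplicity data
and certified rank bounds at small parameters; occurrence obstructions are ruled out in print (BIP'16) —
multiplicity obstructions are the open door; nothing here is a claim on VP vs VNP or P vs NP.

## The statement (census-1's wording, P-027 §1, verbatim up to notation)

«For every det size `n ≥ 2`, every degree `d` with `nd` even, and every EVEN partition `μ ⊢ nd` (all parts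
even) with `ℓ(μ) ≤ min(n,d)²`, EXCEPT the two-column type `μ = (2^{nd/2})` when `n ≠ d` and `(d − n) ∤ d`:
`sk(μ; n×d) ≥ 1`», where `sk(μ; n×d)` = the `Sym²` part of `g(μ, (dⁿ), (dⁿ))` = the multiplicity of `{μ*}` in
`ℂ[GL_{n²}·det_n]_d` (BLMW 2011 (5.2.5)–(5.2.6); tree: `symKroneckerCoeffRect ℂ n d μ`,
`Literature/NumberTheory/DiophantineGeometry/DetOrbitSymKroneckerBound.lean`, with its proved character
formula `two_mul_factorial_mul_symKroneckerCoeffRect`). On the excepted class `g(μ, n×d, n×d) = 0` is a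
THEOREM in print (Ikenmeyer–Panova, Adv. Math. 319 (2017), Prop. 6.6 / Cor. 6.7 = arXiv:1512.03798
Prop. 33 / Cor. 34), so there `sk = 0` and such a type is a CONTROL, not a prediction. Typing choices:
`1 ≤ d` is added (degree `0` is vacuous for the cell); the divisibility clause is read in `ℤ`
(`(d − n) ∣ d`, equivalently `(n − d) ∣ n`; theory-3's K53: the law is symmetric under `n ↔ d`).

## Evidence ledger (why this is typed; none of it is used by Lean)

* census-1 (kron/FLAGS.md F7; INBOX 2026-08-23T03:1xZ l.229): ≈ 4 900 even types over det `n = 2…8` in the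
  cells computed so far, zero exceptions outside the printed two-column class; the two MISSes of the earlier
  variant ((2¹⁴) at {4,7}) ARE that class. Corollary as read by census-1: stretching factor 2 suffices in
  BCI11 Thm 1(2) wherever checked.
* PRE-REGISTRATION P-027 (theory-3, filed 2026-08-23T03:22:16Z BEFORE any of its cells existed on disk):
  cells {5,8} (627 even types; predicted zero set {(2²⁰)} = CONTROL), {6,6} (385; ∅), {6,7} (792; ∅; flagged
  (2²¹): g = 1 so the law predicts sk = 1), fallbacks {6,8}, {5,10}, {6,9}, {7,8}; scoring = both census engines
  (two class-distinct exact kernels). OUTCOME (census-1 gen 3, INBOX l.383, 2026-08-23T05:29:38Z; deposit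
  HOME/kron/p027/, MANIFEST.sha256 `098385542163e8b6`, P027-RESULTS.md `518cab6b85afa57f`; kernels eng_char
  `3400f2f272cc` (Murnaghan–Nakayama class sums) × eng_qh v0.2 `d00ceb15368ca6ce` (Gr(n,n+d) Bethe-point
  quadrature), CRT-stable on 1 804/1 804 rows): (C1) {5,8}: 627 even types = 371 scored + 256 window,
  engines agree 627/627, zero set on the scored rows = {(2²⁰)} = predicted ⇒ HIT (control (2²⁰):
  (sk, ak, g) = (0, 0, 0)); (C2) {6,6}: 385 = 288 + 97, agree 385/385, zero set ∅ = predicted ⇒ HIT (flagged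
  (2¹⁸): (sk, ak, g) = (2, 1, 3)); (C3) {6,7}: 792 = 654 + 138, agree 792/792, zero set ∅ = predicted ⇒ HIT
  (flagged (2²¹): (1, 0, 1) — the unique copy is symmetric, as the law says). REFEREE gen 9 (INBOX l.388,
  05:36:27Z): «P-027 GRADED — (C1) {5,8} HIT, (C2) {6,6} HIT, (C3) {6,7} HIT; AUDITED-PREREG; referee
  recount 33/33» ⇒ standing rule (5) TRIGGERED; LEAD gen 12 D104 (K1 (v) MET: three two-class-scored
  AUDITED-PREREG HITs) and D108 «LIT-1 GO NOW» (INBOX l.393, 05:40:00Z).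
* HISTORY (the two MISS rounds that generated this wording; census-1's numbered negatives, STRUCTURE.md §2 /
  §4.3 pointer l.245, kron/FLAGS.md): P-022 (≡ census-1's 'P-015') stated the length bound as `ℓ ≤ n²` —
  MISS at det 5/6/7/8, `d = 2` → N-C1-3 (the bound is `min(n,d)²`); P-023 (≡ 'P-016') — MISS at `(2¹⁴)` only,
  cells (a) det 4 `d = 7` and (d) det 7 `d = 4` (one zero by K53) → N-C1-4 (the Ikenmeyer–Panova two-column
  zero); census-1 then STOPPED its own variant chain («a third round should be pre-registered by someone who
  has not seen these cells»), whence P-027 by theory-3 on untouched cells.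
* In print nearby (NOT this statement): Bürgisser–Christandl–Ikenmeyer, *Even partitions in plethysms*,
  J. Algebra 328 (2011), Thm 1(2) (positivity after stretching); Ikenmeyer–Panova 2017 (the exception);
  Bessenrodt–Bowman 2023 (S²/Λ² splitting of Kronecker squares, depth ≤ 2); Ressayre 2020 *Vanishing symmetric
  Kronecker coefficients* (acq-03996, unread).

## References

* P. Bürgisser, J. M. Landsberg, L. Manivel, J. Weyman, SIAM J. Comput. 40 (2011), §5.2. [BLMW2011]
* C. Ikenmeyer, G. Panova, *Rectangular Kronecker coefficients and plethysms in geometric complexity theory*,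
  Adv. Math. 319 (2017) 40–66, Prop. 6.6, Cor. 6.7. [IkenmeyerPanova2017]
* P. Bürgisser, M. Christandl, C. Ikenmeyer, *Even partitions in plethysms*, J. Algebra 328 (2011) 322–329. [BurgisserChristandlIkenmeyer2011]
-/

namespace Summit.PneNP.GCT

open Literature.NumberTheory.DiophantineGeometry

/-! ## The typed statement (a definition of a `Prop`; nothing is asserted) -/

/-- **C-C1-1″ (census-1's even-type `sk`-positivity law; cell conjecture, pre-registered as P-027):** for every
determinant size `n ≥ 2`, every degree `d ≥ 1` with `n·d` even, and every even partition `μ ⊢ n·d` with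
`ℓ(μ) ≤ min(n,d)²`, except the two-column type `(2^{nd/2})` when `n ≠ d` and `(d − n) ∤ d` (in `ℤ`), the
rectangular symmetric Kronecker coefficient is positive: `sk(μ; n × d) ≥ 1`. CONJECTURE of the cell with the
evidence ledger of the module docstring; NOT a published theorem (nearest print: BCI11 Thm 1(2), IP17 Cor. 6.7).
[folklore] -/
@[conjecture]
def EvenSymKroneckerPositivity : Prop :=
  ∀ n d : ℕ, 2 ≤ n → 1 ≤ d → Even (n * d) →
    ∀ μ : Nat.Partition (n * d), (∀ p ∈ μ.parts, Even p) → μ.parts.card ≤ (min n d) ^ 2 →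
      ¬ ((∀ p ∈ μ.parts, p = 2) ∧ n ≠ d ∧ ¬ ((d : ℤ) - n ∣ (d : ℤ))) →
      1 ≤ symKroneckerCoeffRect ℂ n d μ

/-- Unfolding of the typed statement (by `rfl`; an `example`, so that the file's only declaration is the
obligation node). [folklore] -/
example :
    EvenSymKroneckerPositivity ↔
      ∀ n d : ℕ, 2 ≤ n → 1 ≤ d → Even (n * d) →
        ∀ μ : Nat.Partition (n * d), (∀ p ∈ μ.parts, Even p) → μ.parts.card ≤ (min n d) ^ 2 →
          ¬ ((∀ p ∈ μ.parts, p = 2) ∧ n ≠ d ∧ ¬ ((d : ℤ) - n ∣ (d : ℤ))) →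
          1 ≤ symKroneckerCoeffRect ℂ n d μ := Iff.rfl

/-- The excepted type is well defined: a partition of `N` all of whose parts equal `2` has exactly `N/2`
parts (`2 · ℓ(μ) = N`), i.e. it is `(2^{N/2})` and `N` is even (sanity check, an `example`). [folklore] -/
example {N : ℕ} (μ : Nat.Partition N) (h : ∀ p ∈ μ.parts, p = 2) : 2 * μ.parts.card = N := by
  have hrep : μ.parts = Multiset.replicate μ.parts.card 2 :=
    Multiset.eq_replicate.mpr ⟨rfl, fun p hp => h p hp⟩
  have hsum := μ.parts_sum
  rw [hrep, Multiset.sum_replicate, smul_eq_mul] at hsum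
  omega

/-- The exception clause at P-027's control cell `{5, 8}`: `5 ≠ 8` and `(8 − 5) ∤ 8`, so the two-column
type `(2²⁰)` is excepted there (IP17 Cor. 6.7: `g = 0`). [folklore] -/
example : (5 : ℕ) ≠ 8 ∧ ¬ ((8 : ℤ) - 5 ∣ (8 : ℤ)) := by decide

/-- … and at `{6, 8}` the clause does NOT fire (`2 ∣ 8`), so the law predicts `sk((2²⁴); 6×8) ≥ 1`
(= 1, since `g = 1` there by IP17 Cor. 6.7). [folklore] -/
example : ((8 : ℤ) - 6 ∣ (8 : ℤ)) := by decide

end Summit.PneNP.GCT
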